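import Summits.QuantumFields.BalabanUV.T4Continuum.Support.RegionMassTwoLevel
import Summits.QuantumFields.BalabanUV.T4Continuum.Support.RegionStarTrace

/-!
# T⁴ programme, spine node NE2 (U1a), sub-row Δ1 «NE2⁰-Dirichlet» — THE MASS-TERM COMMUTATOR IN THE `n_k⁻¹` CLASS ON INTERIOR BUDGETS:
# `√nsq(C_M u) ≤ a·n_k⁻¹·(3‖u‖ + √(2‖u‖² + Σ_ν ‖igrad_ν u‖²))` via leaf-06-g6's trace inequality on the deficient star bonds

NE2 formalisation swarm `b2b-balaban-t4-ne2-formalise-*`, LEAF PROVER 07 (gen 8), owner item O14-b′ «W3-BOX-COMPRESSED», piece **(P-mass)**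
«W3-MASS-PAIRING» (journal 2026-08-20 l.20983 / l.21413; owner rulings R33 (c) / R34 (b)), file 5 (junction with leaf-06-g6's
`Support/RegionStarTrace`, p235726).  File 4 `RegionMassTwoLevel` proves, for EVERY union `S` and every level,
`√nsq(C_M u) ≤ 3a·n_k⁻¹·√nsq u + a·(√n_k)⁻¹·√nsq(P_def u)` with the truncation `P_def u` written inline; here:

 * `truncation_eq_defP_mulVec`: that inline truncation IS `RegionStarTrace.defP *ᵥ u`;
 * `sqrt_nsq_massComm_mulVec_le_defP`: file 4's END in `defP` vocabulary;
 * **`sqrt_nsq_massComm_mulVec_le_interior`**: with `RegionStarTrace.trace_deficient_le` (`‖P_def u‖² ≤ (2‖u‖² + Σ_ν ‖igrad_ν u‖²)/n`, no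
   hypothesis) the boundary term joins the `n_k⁻¹` class: `√nsq(C_M u) ≤ a·n_k⁻¹·(3·√nsq u + √(2·nsq u + Σ_ν nsq (igrad_ν u)))` — i.e. the
   (P-mass) pairing holds at the TORUS RATE `L^{−k}` with the INTERIOR budget `E(u) = nsq u + Σ_ν nsq (igrad_ν u)` (level-free on coordinate
   boxes by W1 `RegionSliceCoerciveBox.sliceCoercive_lev_box` + leaf-07-g7's interior W2 `RegionInteriorW2.interiorW2_of_slice`) and `E′(v) = nsq v`,
   exactly the budget shape of owner R34 (b).

HONEST FRAMING (T4-DAG p. 1).  Model level (`U = 1`, ONE region — any union of unit blocks —, ONE averaging scale, finite torus, operator norm);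
[folklore] composition BY NAME of landed modules; ONE summand of ONE displayed binder (W3-compressed); (P-gaffney) / (P-gauge) / (R-hess) untouched;
W3 on boxes OPEN; Δ1 NOT closed; NE2 (U1a) NOT proved; spine PROVED 0/9 unchanged; NOT [B9] (3.16)/(3.23)–(3.27) as printed; NOT infinite
volume, NOT a mass gap, NOT the Clay problem, NOT summit progress.  HONEST DEPENDENCY: continuum YM on T⁴ ⇐ BetaPertH ∧ nine spine estimates
(0/9 proved); BetaPertH ⇐ (D1) ∧ (D4) ∧ CAP+tail; G-an2-4 gates asym, D1 and NE2/3/4.  No `sorry`.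
-/

noncomputable section

open scoped BigOperators ComplexConjugate Matrix Matrix.Norms.L2Operator
open Finset

namespace Summit.QuantumFields.BalabanUV.T4Continuum.RegionMassTwoLevelTrace

open Literature.MathematicalPhysics.QuantumFieldTheory.Balaban1983to89.B5Prop11Plancherel (Tor fine)
open Literature.MathematicalPhysics.QuantumFieldTheory.Balaban1983to89.B5Prop11Lower (nsq nsq_nonneg)
open Literature.MathematicalPhysics.QuantumFieldTheory.Balaban1983to89.B5Block118 (QvOp)
open Literature.MathematicalPhysics.QuantumFieldTheory.Balaban1983to89.B5G183RateUnitTower (lev)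
open Summit.QuantumFields.BalabanUV.T4Continuum
open Summit.QuantumFields.BalabanUV.T4Continuum.DirichletSubregionTowerOf (pidx JpR)
open Summit.QuantumFields.BalabanUV.T4Continuum.DirichletStarVectorTower (starP)
open Summit.QuantumFields.BalabanUV.T4Continuum.DirichletStarRenormTower (igrad)
open Summit.QuantumFields.BalabanUV.T4Continuum.RegionGaugeFixedVector (starReg avgR)
open Summit.QuantumFields.BalabanUV.T4Continuum.RegionStarTrace (defP defP_mulVec nsq_defP_mulVec trace_deficient_le)
open Summit.QuantumFields.BalabanUV.T4Continuum.RegionMassTwoLevel (sqrt_nsq_massComm_mulVec_le)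
open Summit.QuantumFields.BalabanUV.Beta.GAN24.DirichletBoxTrace (blockReg)

variable {d : ℕ} (L : ℕ) [NeZero L] (M : Fin d → ℕ) [hM : ∀ μ, NeZero (M μ)] (S : Tor M → Prop) [DecidablePred S] (a : ℝ)

/-- the inline truncation of `RegionMassTwoLevel` IS leaf-06-g6's `P_def`. [folklore] -/
theorem truncation_eq_defP_mulVec (n : ℕ) [NeZero n] (u : {b // starReg n M S b} → ℂ) :
    (fun b : {b // starReg n M S b} => if blockReg n M S b.1.1 then 0 else u b) = defP n M S *ᵥ u := by
  funext b; rw [defP_mulVec]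

/-- **THE MASS-TERM COMMUTATOR WITH `P_def`**: `√nsq(C_M u) ≤ 3a·n_k⁻¹·√nsq u + a·(√n_k)⁻¹·√nsq(P_def u)`. [folklore] -/
theorem sqrt_nsq_massComm_mulVec_le_defP (ha : 0 ≤ a) (k : ℕ) (u : pidx L M (starP L M S) k → ℂ) :
    Real.sqrt (nsq ((JpR L M (starP L M S) k * ((((a * ((lev L k : ℕ) : ℝ) ^ d : ℝ)) : ℂ) • ((avgR (lev L k) M S)ᴴ * avgR (lev L k) M S))
        - ((((a * ((lev L (k + 1) : ℕ) : ℝ) ^ d : ℝ)) : ℂ) • ((avgR (lev L (k + 1)) M S)ᴴ * avgR (lev L (k + 1)) M S))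
          * JpR L M (starP L M S) k) *ᵥ u))
      ≤ 3 * a * (((lev L k : ℕ) : ℝ))⁻¹ * Real.sqrt (nsq u)
        + a * (Real.sqrt ((lev L k : ℕ) : ℝ))⁻¹ * Real.sqrt (nsq (defP (lev L k) M S *ᵥ u)) := by
  rw [← truncation_eq_defP_mulVec]
  exact sqrt_nsq_massComm_mulVec_le L M S a ha k u

/-- **THE MASS-TERM COMMUTATOR IN THE `n_k⁻¹` CLASS ON INTERIOR BUDGETS**: by leaf-06-g6's trace inequality
(`RegionStarTrace.trace_deficient_le`: `‖P_def u‖² ≤ (2‖u‖² + Σ_ν ‖igrad_ν u‖²)/n`),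
`√nsq(C_M u) ≤ a·n_k⁻¹·(3·√nsq u + √(2·nsq u + Σ_ν nsq (igrad_ν u)))` — budgets `E(u) = nsq u + Σ_ν nsq (igrad_ν u)` (level-free on
coordinate boxes by W1 `RegionSliceCoerciveBox.sliceCoercive_lev_box` + leaf-07-g7's interior W2 `RegionInteriorW2.interiorW2_of_slice`),
`E′(v) = nsq v`, `ε_k ≍ a·L^{−k}`: the TORUS RATE for the (P-mass) piece. [folklore] -/
theorem sqrt_nsq_massComm_mulVec_le_interior (ha : 0 ≤ a) (k : ℕ) (u : pidx L M (starP L M S) k → ℂ) :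
    Real.sqrt (nsq ((JpR L M (starP L M S) k * ((((a * ((lev L k : ℕ) : ℝ) ^ d : ℝ)) : ℂ) • ((avgR (lev L k) M S)ᴴ * avgR (lev L k) M S))
        - ((((a * ((lev L (k + 1) : ℕ) : ℝ) ^ d : ℝ)) : ℂ) • ((avgR (lev L (k + 1)) M S)ᴴ * avgR (lev L (k + 1)) M S))
          * JpR L M (starP L M S) k) *ᵥ u))
      ≤ a * (((lev L k : ℕ) : ℝ))⁻¹
          * (3 * Real.sqrt (nsq u) + Real.sqrt (2 * nsq u + ∑ ν, nsq (igrad M S (lev L k) ν u))) := by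
  have hn : (0 : ℝ) < ((lev L k : ℕ) : ℝ) := by exact_mod_cast Nat.pos_of_ne_zero (NeZero.ne (lev L k))
  have hsn : 0 < Real.sqrt (((lev L k : ℕ) : ℝ)) := Real.sqrt_pos.mpr hn
  have h := sqrt_nsq_massComm_mulVec_le_defP L M S a ha k u
  -- the trace inequality on the spike charge
  have htr : Real.sqrt (nsq (defP (lev L k) M S *ᵥ u))
      ≤ (Real.sqrt ((lev L k : ℕ) : ℝ))⁻¹ * Real.sqrt (2 * nsq u + ∑ ν, nsq (igrad M S (lev L k) ν u)) := by
    rw [nsq_defP_mulVec, ← Real.sqrt_inv, ← Real.sqrt_mul (inv_nonneg.mpr hn.le)]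
    refine Real.sqrt_le_sqrt ?_
    rw [inv_mul_eq_div]
    exact trace_deficient_le (lev L k) M S u
  refine h.trans ?_
  have e : a * (((lev L k : ℕ) : ℝ))⁻¹ * (3 * Real.sqrt (nsq u) + Real.sqrt (2 * nsq u + ∑ ν, nsq (igrad M S (lev L k) ν u)))
      = 3 * a * (((lev L k : ℕ) : ℝ))⁻¹ * Real.sqrt (nsq u)
        + a * (Real.sqrt ((lev L k : ℕ) : ℝ))⁻¹ * ((Real.sqrt ((lev L k : ℕ) : ℝ))⁻¹
          * Real.sqrt (2 * nsq u + ∑ ν, nsq (igrad M S (lev L k) ν u))) := by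
    have hss : (Real.sqrt ((lev L k : ℕ) : ℝ))⁻¹ * (Real.sqrt ((lev L k : ℕ) : ℝ))⁻¹ = (((lev L k : ℕ) : ℝ))⁻¹ := by
      rw [← mul_inv, Real.mul_self_sqrt hn.le]
    rw [← hss]
    ring
  rw [e]
  gcongr

end Summit.QuantumFields.BalabanUV.T4Continuum.RegionMassTwoLevelTrace

end
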